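import Summits.AtomisticToContinuum.Crystallization.Theorems.FrustratedLawDichotomyAperiodicGapNoPairCut
import Summits.AtomisticToContinuum.Crystallization.Theorems.FrustratedLawDichotomyNashStabilityMoments

/-!
# FrustratedLawDichotomy · crux `AperiodicFrustratedLawGap` (stmt-AtomisticToContinuum-27623) — THE VACANCY FIELD and the
# two-point inequality of the Nash clause (e) read GLOBALLY (decomp-a2c, prover hand 1, direct share, generation 5; part 1 of 2)

Hand 1 read clause (e) LOCALLY in generation 3 (force balance `FrustratedLawDichotomyNashForceBalance`, line / Laplacian
stability `FrustratedLawDichotomyNashLocalStability`).  Clause (e) is a GLOBAL statement — an atom `p` may be moved to ANY position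
`y` off the other atoms — and its global content is a two-point inequality between the one-particle energy of an atom and the
Lennard-Jones FIELD of the configuration at a vacant point `y`:

  `h(p) = Σ_{q ≠ p} V_LJ(|p − q|) ≤ Σ_{q ≠ p} V_LJ(|y − q|) = Φ_μ(y) − V_LJ(|y − p|) ≤ Φ_μ(y) + 1/12`,
  `Φ_μ(y) := Σ_{q atom} V_LJ(|y − q|)` (`V_LJ ≥ −1/12`).

This file is the deterministic part (no law, no floor):
* §1 the potential: `neg_le_lennardJones` (`V_LJ ≥ −1/12`), `abs_lennardJones_le`, continuity off `0`;
* §2 the field of a `δ`-separated set `S` at a point `y` at positive distance from it: `summable_lennardJones_dist` (shell counting),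
  the dictionary `tsum_lennardJones_dist_eq_parts` (the series `Σ'_{q ∈ S} V_LJ(dist y q)` equals the difference of the FINITE
  `ℝ≥0∞` parts `∫⁻ V_LJ(dist y ·)^± d(count|S)` — the Giry-measurable form used at law level), and OPENNESS of the deep-hole set in the
  countable form needed for measurability: `exists_denseSeq_hole` (if the field at a point off `S` is `< c`, it is `< c` at a term of the
  dense sequence off `S`; continuity of the field off the atoms by dominated shell sums, `continuousOn_tsum`);
* §3 at the root: `two_mul_rootEnergy_eq_tsum` (`2·rootEnergy V_LJ (count|S) = Σ'_{q ∈ S ∖ {0}} V_LJ(dist 0 q)`) and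
  **`two_mul_rootEnergy_le_field_of_nash`** — for a rooted `δ`-hard-core `μ` whose root passes the one-particle Nash test of the crux
  (clause (e) at `p = 0`, verbatim) and a vacant `y` (`μ {y} = 0`): `2·rootEnergy V_LJ μ ≤ Φ_μ(y) + 1/12`.

Part 2 (`FrustratedLawDichotomyVacancyFloor`) turns this into the law-level VACANCY FLOOR «no deep holes»: under clauses (a)(b)(e) and
the energy floor of item 9229, almost surely `Φ_μ(y) ≥ 2e⋆ − 1/12` at every vacant `y` — one deep hole anywhere forces every
one-particle energy below `2e⋆` on a re-rooting-invariant event, contradicting the floor for the conditioned law; no minimality is used.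
All `[folklore]` (global one-particle optimality; shell sums).
-/

noncomputable section

namespace Summit.AtomisticToContinuum.Crystallization.Theorems.FrustratedLawDichotomyVacancyField

open MeasureTheory Metric Set Filter Topology TopologicalSpace
open scoped ENNReal BigOperators
open Literature.MathematicalPhysics.StatisticalMechanics Literature.Probability.Process
open Literature.Probability.Process.LocalConfig (isClosed_of_separated finite_inter_of_separated)
open Summit.AtomisticToContinuum.Crystallization.Theorems.ChargedEnergyGapNegative (E3 eStar)
open Summit.AtomisticToContinuum.Crystallization.Theorems.FrustratedLawDichotomyNashLocalStability (summable_inv_pow_six_of_sep)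
open Summit.AtomisticToContinuum.Crystallization.Theorems.FrustratedLawDichotomyFiniteClusterGap
  (integrable_rootEnergy_of_ae_hardCore setOf_count_restrict_singleton_ne_zero ae_mem_of_sep)
open Summit.AtomisticToContinuum.Crystallization.Theorems.FrustratedLawDichotomyAperiodicGapFiniteCut
  (isPointStationaryLaw_restrict_of_hc_invariant isProbabilityMeasure_cond')

/-! ## §1. The potential -/

section Potential

/-- `V_LJ ≥ −1/12` (its minimum, at distance `1`). [folklore] -/
theorem neg_le_lennardJones (r : ℝ) : -(1 / 12 : ℝ) ≤ lennardJones r := by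
  unfold lennardJones
  have hsq : (r⁻¹ ^ 6) ^ 2 = r⁻¹ ^ 12 := by ring
  nlinarith [sq_nonneg (r⁻¹ ^ 6 - 1)]

/-- `|V_LJ(r)| ≤ r⁻¹²/12 + r⁻⁶/6`. [folklore] -/
theorem abs_lennardJones_le (r : ℝ) : |lennardJones r| ≤ 1 / 12 * r⁻¹ ^ 12 + 1 / 6 * r⁻¹ ^ 6 := by
  unfold lennardJones
  have h12 : 0 ≤ r⁻¹ ^ 12 := by positivity
  have h6 : 0 ≤ r⁻¹ ^ 6 := by positivity
  rw [abs_le]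
  constructor <;> nlinarith

/-- `y ↦ V_LJ(dist y q)` is continuous on any set avoiding `q`. [folklore] -/
theorem continuousOn_lennardJones_dist (q : E3) {s : Set E3} (hs : ∀ y ∈ s, y ≠ q) :
    ContinuousOn (fun y : E3 => lennardJones (dist y q)) s := by
  have hd : ContinuousOn (fun y : E3 => (dist y q)⁻¹) s :=
    ((continuous_id.dist continuous_const).continuousOn).inv₀ fun y hy => (dist_pos.2 (hs y hy)).ne'
  have h : (fun y : E3 => lennardJones (dist y q)) = fun y => 1 / 12 * (dist y q)⁻¹ ^ 12 - 1 / 6 * (dist y q)⁻¹ ^ 6 := by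
    funext y; rfl
  rw [h]
  exact ((hd.pow 12).const_smul (1 / 12 : ℝ)).sub ((hd.pow 6).const_smul (1 / 6 : ℝ)) |>.congr fun y _ => by
    simp [smul_eq_mul]

end Potential

/-! ## §2. The field of a separated configuration at a point off its atoms -/

section Field

variable {δ : ℝ} {S : Set E3}

/-- A point off a `δ`-separated set is at positive distance from it. [folklore] -/
theorem exists_pos_forall_le_dist (hδ : 0 < δ) (hsep : ∀ x ∈ S, ∀ z ∈ S, x ≠ z → δ ≤ dist x z) {y : E3} (hy : y ∉ S) :
    ∃ ρ : ℝ, 0 < ρ ∧ ∀ q ∈ S, ρ ≤ dist y q := by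
  have hopen : IsOpen Sᶜ := (isClosed_of_separated hδ hsep).isOpen_compl
  obtain ⟨ρ, hρ, hball⟩ := Metric.isOpen_iff.1 hopen y hy
  refine ⟨ρ, hρ, fun q hq => ?_⟩
  by_contra hlt
  exact hball (mem_ball'.2 (not_le.1 hlt)) hq

/-- **Summability of the field series** `q ↦ V_LJ(dist y q)` over a `δ`-separated set `S`, at a point `y` at distance `≥ ρ > 0` from
`S` (shell counting: `Σ |·|⁻⁶` converges, `|V_LJ(r)| ≤ (ρ'⁻⁶/12 + 1/6) r⁻⁶` for `r ≥ ρ' = min δ ρ`). [folklore] -/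
theorem summable_lennardJones_dist (hδ : 0 < δ) (hsep : ∀ x ∈ S, ∀ z ∈ S, x ≠ z → δ ≤ dist x z) {y : E3} {ρ : ℝ}
    (hρ : 0 < ρ) (hfar : ∀ q ∈ S, ρ ≤ dist y q) :
    Summable fun q : S => lennardJones (dist y (q : E3)) := by
  set δ' : ℝ := min δ ρ with hδ'
  have hδ'0 : 0 < δ' := lt_min hδ hρ
  have hsep' : ∀ x ∈ S, ∀ z ∈ S, x ≠ z → δ' ≤ dist x z := fun x hx z hz hxz => (min_le_left _ _).trans (hsep x hx z hz hxz)
  have hfar' : ∀ q ∈ S, δ' ≤ dist y q := fun q hq => (min_le_right _ _).trans (hfar q hq)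
  have h6 : Summable fun q : S => (dist y (q : E3))⁻¹ ^ 6 :=
    summable_inv_pow_six_of_sep (S := S) (Y := S) hδ'0 hsep' subset_rfl hfar'
  refine Summable.of_norm_bounded (h6.mul_left (1 / 12 * δ'⁻¹ ^ 6 + 1 / 6)) fun q => ?_
  rw [Real.norm_eq_abs]
  have hdq : δ' ≤ dist y (q : E3) := hfar' q q.2
  have hdpos : 0 < dist y (q : E3) := hδ'0.trans_le hdq
  have hinv : (dist y (q : E3))⁻¹ ^ 6 ≤ δ'⁻¹ ^ 6 :=
    pow_le_pow_left₀ (inv_nonneg.2 hdpos.le) ((inv_le_inv₀ hdpos hδ'0).2 hdq) 6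
  have h6nn : 0 ≤ (dist y (q : E3))⁻¹ ^ 6 := by positivity
  have h12 : (dist y (q : E3))⁻¹ ^ 12 = (dist y (q : E3))⁻¹ ^ 6 * (dist y (q : E3))⁻¹ ^ 6 := by ring
  calc |lennardJones (dist y (q : E3))| ≤ 1 / 12 * (dist y (q : E3))⁻¹ ^ 12 + 1 / 6 * (dist y (q : E3))⁻¹ ^ 6 :=
        abs_lennardJones_le _
    _ ≤ (1 / 12 * δ'⁻¹ ^ 6 + 1 / 6) * (dist y (q : E3))⁻¹ ^ 6 := by
        rw [h12]; nlinarith [mul_le_mul_of_nonneg_left hinv h6nn]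

/-- **Series = parts.**  At a point `y` at positive distance from the `δ`-separated set `S`, the `ℝ≥0∞` parts
`∫⁻ V_LJ(dist y ·)^± d(count|S)` are finite and the field series is their difference:
`Σ'_{q ∈ S} V_LJ(dist y q) = (∫⁻ V⁺).toReal − (∫⁻ V⁻).toReal`. [folklore] -/
theorem tsum_lennardJones_dist_eq_parts (hδ : 0 < δ) (hsep : ∀ x ∈ S, ∀ z ∈ S, x ≠ z → δ ≤ dist x z) {y : E3} {ρ : ℝ}
    (hρ : 0 < ρ) (hfar : ∀ q ∈ S, ρ ≤ dist y q) :
    ∫⁻ z, ENNReal.ofReal (lennardJones (dist y z)) ∂((Measure.count : Measure E3).restrict S) ≠ ∞ ∧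
      ∫⁻ z, ENNReal.ofReal (-lennardJones (dist y z)) ∂((Measure.count : Measure E3).restrict S) ≠ ∞ ∧
      ∑' q : S, lennardJones (dist y (q : E3)) =
        (∫⁻ z, ENNReal.ofReal (lennardJones (dist y z)) ∂((Measure.count : Measure E3).restrict S)).toReal -
          (∫⁻ z, ENNReal.ofReal (-lennardJones (dist y z)) ∂((Measure.count : Measure E3).restrict S)).toReal := by
  have hS : S.Countable := by
    have hcov : S = ⋃ n : ℕ, closedBall (0 : E3) n ∩ S := by
      ext x
      simp only [mem_iUnion, mem_inter_iff, mem_closedBall]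
      exact ⟨fun hx => let ⟨n, hn⟩ := exists_nat_ge (dist x 0); ⟨n, hn, hx⟩, fun ⟨_, _, hx⟩ => hx⟩
    rw [hcov]
    exact countable_iUnion fun n => (finite_inter_of_separated hδ hsep (isCompact_closedBall (0 : E3) n)).countable
  have hsum := summable_lennardJones_dist hδ hsep hρ hfar
  set f : S → ℝ := fun q => lennardJones (dist y (q : E3)) with hf
  have habs : Summable fun q => |f q| := hsum.abs
  have hpos : Summable fun q => max (f q) 0 :=
    Summable.of_nonneg_of_le (fun q => le_max_right _ _) (fun q => max_le (le_abs_self _) (abs_nonneg _)) habs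
  have hneg : Summable fun q => max (-f q) 0 :=
    Summable.of_nonneg_of_le (fun q => le_max_right _ _) (fun q => max_le (neg_le_abs _) (abs_nonneg _)) habs
  -- the parts as series
  have hofReal_max : ∀ x : ℝ, ENNReal.ofReal x = ENNReal.ofReal (max x 0) := fun x => by
    rcases le_total 0 x with h | h
    · rw [max_eq_left h]
    · rw [max_eq_right h, ENNReal.ofReal_of_nonpos h, ENNReal.ofReal_zero]
  have hP : ∫⁻ z, ENNReal.ofReal (lennardJones (dist y z)) ∂((Measure.count : Measure E3).restrict S) =
      ENNReal.ofReal (∑' q : S, max (f q) 0) := by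
    rw [lintegral_countable _ hS, ENNReal.ofReal_tsum_of_nonneg (fun q => le_max_right _ _) hpos]
    refine tsum_congr fun q => ?_
    rw [Measure.count_singleton, mul_one, hofReal_max]
  have hN : ∫⁻ z, ENNReal.ofReal (-lennardJones (dist y z)) ∂((Measure.count : Measure E3).restrict S) =
      ENNReal.ofReal (∑' q : S, max (-f q) 0) := by
    rw [lintegral_countable _ hS, ENNReal.ofReal_tsum_of_nonneg (fun q => le_max_right _ _) hneg]
    refine tsum_congr fun q => ?_
    rw [Measure.count_singleton, mul_one, hofReal_max]
  refine ⟨by rw [hP]; exact ENNReal.ofReal_ne_top, by rw [hN]; exact ENNReal.ofReal_ne_top, ?_⟩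
  rw [hP, hN, ENNReal.toReal_ofReal (tsum_nonneg fun q => le_max_right _ _),
    ENNReal.toReal_ofReal (tsum_nonneg fun q => le_max_right _ _), ← hpos.tsum_sub hneg]
  exact tsum_congr fun q => (max_zero_sub_max_neg_zero_eq_self (f q)).symm

/-- **Continuity of the field off the atoms**, in the countable form used below: if the field series at a point `y` at positive
distance from the `δ`-separated set `S` is `< c`, then so it is at some term of the dense sequence which is also off `S`, and the parts
there satisfy `(∫⁻ V⁺).toReal − (∫⁻ V⁻).toReal < c`. [folklore] -/
theorem exists_denseSeq_hole (hδ : 0 < δ) (hsep : ∀ x ∈ S, ∀ z ∈ S, x ≠ z → δ ≤ dist x z) {y : E3} (hy : y ∉ S) {c : ℝ}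
    (hc : (∫⁻ z, ENNReal.ofReal (lennardJones (dist y z)) ∂((Measure.count : Measure E3).restrict S)).toReal -
      (∫⁻ z, ENNReal.ofReal (-lennardJones (dist y z)) ∂((Measure.count : Measure E3).restrict S)).toReal < c) :
    ∃ n : ℕ, denseSeq E3 n ∉ S ∧
      (∫⁻ z, ENNReal.ofReal (lennardJones (dist (denseSeq E3 n) z)) ∂((Measure.count : Measure E3).restrict S)).toReal -
        (∫⁻ z, ENNReal.ofReal (-lennardJones (dist (denseSeq E3 n) z)) ∂((Measure.count : Measure E3).restrict S)).toReal < c := by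
  obtain ⟨ρ, hρ, hfar⟩ := exists_pos_forall_le_dist hδ hsep hy
  -- on the closed ball `B̄(y, ρ/2)` every point is at distance `≥ ρ/2` from `S`
  set s : Set E3 := closedBall y (ρ / 2) with hs
  have hfar_s : ∀ y' ∈ s, ∀ q ∈ S, ρ / 2 ≤ dist y' q := by
    intro y' hy' q hq
    have h1 := hfar q hq
    have h2 : dist y' y ≤ ρ / 2 := mem_closedBall.1 hy'
    linarith [dist_triangle y y' q, dist_comm y y']
  -- the field series is continuous on `s` (dominated by summable shell terms)
  set F : E3 → ℝ := fun y' => ∑' q : S, lennardJones (dist y' (q : E3)) with hF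
  set δ' : ℝ := min δ (ρ / 2) with hδ'
  have hδ'0 : 0 < δ' := lt_min hδ (by linarith)
  have hsep' : ∀ x ∈ S, ∀ z ∈ S, x ≠ z → δ' ≤ dist x z := fun x hx z hz hxz => (min_le_left _ _).trans (hsep x hx z hz hxz)
  have h6 : Summable fun q : S => (dist y (q : E3))⁻¹ ^ 6 :=
    summable_inv_pow_six_of_sep (S := S) (Y := S) hδ'0 hsep' subset_rfl fun q hq => (min_le_right _ _).trans (by linarith [hfar q hq])
  have hcont : ContinuousOn F s := by
    refine continuousOn_tsum (u := fun q : S => (1 / 12 * (δ' / 2)⁻¹ ^ 6 + 1 / 6) * (2 ^ 6 * (dist y (q : E3))⁻¹ ^ 6))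
      (fun q => continuousOn_lennardJones_dist (q : E3) fun y' hy' hq => ?_)
      ((h6.mul_left ((1 / 12 * (δ' / 2)⁻¹ ^ 6 + 1 / 6) * 2 ^ 6)).congr fun q => by ring) ?_
    · have := hfar_s y' hy' q q.2
      rw [hq, dist_self] at this
      linarith
    · intro q y' hy'
      rw [Real.norm_eq_abs]
      have hdq : ρ / 2 ≤ dist y' (q : E3) := hfar_s y' hy' q q.2
      have hδq : δ' / 2 ≤ dist y' (q : E3) := by linarith [min_le_right δ (ρ / 2), hδ'0]
      have hdpos : 0 < dist y' (q : E3) := by linarith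
      -- `dist y' q ≥ dist y q / 2`
      have hhalf : dist y (q : E3) / 2 ≤ dist y' (q : E3) := by
        have h2 : dist y' y ≤ ρ / 2 := mem_closedBall.1 hy'
        linarith [dist_triangle y y' q, dist_comm y y', hfar q q.2]
      have hyq : 0 < dist y (q : E3) := hρ.trans_le (hfar q q.2)
      have hinv1 : (dist y' (q : E3))⁻¹ ≤ 2 * (dist y (q : E3))⁻¹ := by
        rw [show 2 * (dist y (q : E3))⁻¹ = (dist y (q : E3) / 2)⁻¹ by field_simp]
        exact (inv_le_inv₀ hdpos (by positivity)).2 hhalf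
      have hinv6 : (dist y' (q : E3))⁻¹ ^ 6 ≤ 2 ^ 6 * (dist y (q : E3))⁻¹ ^ 6 := by
        rw [← mul_pow]; exact pow_le_pow_left₀ (inv_nonneg.2 hdpos.le) hinv1 6
      have hinvδ : (dist y' (q : E3))⁻¹ ^ 6 ≤ (δ' / 2)⁻¹ ^ 6 :=
        pow_le_pow_left₀ (inv_nonneg.2 hdpos.le) ((inv_le_inv₀ hdpos (by positivity)).2 hδq) 6
      have h6nn : 0 ≤ (dist y' (q : E3))⁻¹ ^ 6 := by positivity
      have h12 : (dist y' (q : E3))⁻¹ ^ 12 = (dist y' (q : E3))⁻¹ ^ 6 * (dist y' (q : E3))⁻¹ ^ 6 := by ring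
      have hC : 0 ≤ 1 / 12 * (δ' / 2)⁻¹ ^ 6 + 1 / 6 := by positivity
      calc |lennardJones (dist y' (q : E3))| ≤ 1 / 12 * (dist y' (q : E3))⁻¹ ^ 12 + 1 / 6 * (dist y' (q : E3))⁻¹ ^ 6 :=
            abs_lennardJones_le _
        _ ≤ (1 / 12 * (δ' / 2)⁻¹ ^ 6 + 1 / 6) * (dist y' (q : E3))⁻¹ ^ 6 := by
            rw [h12]; nlinarith [mul_le_mul_of_nonneg_left hinvδ h6nn]
        _ ≤ (1 / 12 * (δ' / 2)⁻¹ ^ 6 + 1 / 6) * (2 ^ 6 * (dist y (q : E3))⁻¹ ^ 6) := mul_le_mul_of_nonneg_left hinv6 hC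
  -- the value at `y` is `< c`, hence so on a small ball around `y`
  have hFy : F y < c := by
    rw [hF]
    simp only
    rw [(tsum_lennardJones_dist_eq_parts hδ hsep hρ hfar).2.2]
    exact hc
  have hys : y ∈ s := mem_closedBall_self (by linarith)
  have hev : ∀ᶠ y' in 𝓝[s] y, F y' < c := (hcont y hys).eventually (gt_mem_nhds hFy)
  obtain ⟨U, hU, hUopen, hyU, hUsub⟩ : ∃ U, (∀ y' ∈ U ∩ s, F y' < c) ∧ IsOpen U ∧ y ∈ U ∧ True := by
    obtain ⟨U, hUopen, hyU, hU⟩ := mem_nhdsWithin.1 hev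
    exact ⟨U, fun y' hy' => hU hy', hUopen, hyU, trivial⟩
  -- a dense-sequence term inside `U ∩ B(y, ρ/2)`
  have hopen : IsOpen (U ∩ ball y (ρ / 2)) := hUopen.inter isOpen_ball
  have hne : (U ∩ ball y (ρ / 2)).Nonempty := ⟨y, hyU, mem_ball_self (by linarith)⟩
  obtain ⟨n, hn⟩ := (denseRange_denseSeq E3).exists_mem_open hopen hne
  have hns : denseSeq E3 n ∈ s := mem_closedBall.2 (mem_ball.1 hn.2).le
  have hfar_n : ∀ q ∈ S, ρ / 2 ≤ dist (denseSeq E3 n) q := hfar_s _ hns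
  have hnS : denseSeq E3 n ∉ S := fun h => by
    have := hfar_n _ h
    rw [dist_self] at this
    linarith
  refine ⟨n, hnS, ?_⟩
  rw [← (tsum_lennardJones_dist_eq_parts hδ hsep (by linarith : (0 : ℝ) < ρ / 2) hfar_n).2.2]
  exact hU _ ⟨hn.1, hns⟩

end Field

/-! ## §3. At the root: the one-particle energy, and the two-point inequality of the Nash clause -/

section Root

variable {δ : ℝ} {μ : Measure E3}

/-- **The root's one-particle energy as a series**: for a rooted `δ`-separated `S ∋ 0`,
`2·rootEnergy V_LJ (count|S) = Σ'_{q ∈ S ∖ {0}} V_LJ(dist 0 q)` (the root's own term is `V_LJ(0) = 0`). [folklore] -/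
theorem two_mul_rootEnergy_eq_tsum (hδ : 0 < δ) {S : Set E3} (h0 : (0 : E3) ∈ S)
    (hsep : ∀ x ∈ S, ∀ z ∈ S, x ≠ z → δ ≤ dist x z) :
    2 * rootEnergy lennardJones ((Measure.count : Measure E3).restrict S) =
      ∑' q : ↥(S \ {0}), lennardJones (dist (0 : E3) (q : E3)) := by
  have hsep' : ∀ x ∈ S \ {0}, ∀ z ∈ S \ {0}, x ≠ z → δ ≤ dist x z := fun x hx z hz h => hsep x hx.1 z hz.1 h
  have hfar : ∀ q ∈ S \ {0}, δ ≤ dist (0 : E3) q := fun q hq =>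
    hsep 0 h0 q hq.1 fun h => hq.2 (h ▸ mem_singleton _)
  obtain ⟨hP, hN, htsum⟩ := tsum_lennardJones_dist_eq_parts hδ hsep' hδ hfar
  have hmeas : Measurable fun z : E3 => lennardJones (dist (0 : E3) z) :=
    (show Measurable lennardJones by unfold lennardJones; fun_prop).comp (measurable_const.dist measurable_id)
  -- the Bochner integral over `count|(S ∖ {0})` is the difference of the parts
  have hint : Integrable (fun z : E3 => lennardJones (dist (0 : E3) z)) ((Measure.count : Measure E3).restrict (S \ {0})) := by
    refine ⟨hmeas.aestronglyMeasurable, ?_⟩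
    show ∫⁻ z, ‖lennardJones (dist (0 : E3) z)‖ₑ ∂((Measure.count : Measure E3).restrict (S \ {0})) < ∞
    calc ∫⁻ z, ‖lennardJones (dist (0 : E3) z)‖ₑ ∂((Measure.count : Measure E3).restrict (S \ {0}))
        ≤ ∫⁻ z, (ENNReal.ofReal (lennardJones (dist (0 : E3) z)) + ENNReal.ofReal (-lennardJones (dist (0 : E3) z)))
            ∂((Measure.count : Measure E3).restrict (S \ {0})) := lintegral_mono fun z => by
          rw [Real.enorm_eq_ofReal_abs]
          rcases le_total 0 (lennardJones (dist (0 : E3) z)) with h | h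
          · rw [abs_of_nonneg h]; exact le_self_add
          · rw [abs_of_nonpos h, ENNReal.ofReal_of_nonpos h, zero_add]
      _ = (∫⁻ z, ENNReal.ofReal (lennardJones (dist (0 : E3) z)) ∂((Measure.count : Measure E3).restrict (S \ {0}))) +
            ∫⁻ z, ENNReal.ofReal (-lennardJones (dist (0 : E3) z)) ∂((Measure.count : Measure E3).restrict (S \ {0})) :=
          lintegral_add_left (ENNReal.measurable_ofReal.comp hmeas) _
      _ < ∞ := ENNReal.add_lt_top.2 ⟨lt_top_iff_ne_top.2 hP, lt_top_iff_ne_top.2 hN⟩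
  -- `2·rootEnergy = ∫ V_LJ ‖z‖ d(count|S) = ∫ over `S ∖ {0}` (the root term vanishes)
  rw [rootEnergy_def]
  have hnorm : (fun z : E3 => lennardJones ‖z‖) = fun z => lennardJones (dist (0 : E3) z) := by
    funext z; rw [dist_comm, dist_zero_right]
  have hvan : ∀ z : E3, z ∉ ({0}ᶜ : Set E3) → lennardJones (dist (0 : E3) z) = 0 := by
    intro z hz
    rw [mem_compl_iff, not_not, mem_singleton_iff] at hz
    rw [hz, dist_self, lennardJones_zero]
  rw [hnorm, ← setIntegral_eq_integral_of_forall_compl_eq_zero hvan, Measure.restrict_restrict (measurableSet_singleton 0).compl,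
    show ({0}ᶜ : Set E3) ∩ S = S \ {0} from Set.ext fun z => ⟨fun h => ⟨h.2, h.1⟩, fun h => ⟨h.2, h.1⟩⟩,
    integral_eq_lintegral_pos_part_sub_lintegral_neg_part hint, htsum]
  ring

/-- **THE TWO-POINT INEQUALITY OF THE NASH CLAUSE** (deterministic, global).  Let `μ` be a rooted `δ`-hard-core configuration whose
ROOT passes the one-particle Nash test of the crux (clause (e) at `p = 0`, verbatim) and `y` a vacant point (`μ {y} = 0`).  Then
`2·rootEnergy V_LJ μ ≤ Φ_μ(y) − V_LJ(‖y‖) ≤ Φ_μ(y) + 1/12`, the field `Φ_μ(y)` written through its `ℝ≥0∞` parts. [folklore] -/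
theorem two_mul_rootEnergy_le_field_of_nash (hδ : 0 < δ) (hμ : IsRootedHardCore δ μ)
    (hNash : ∀ y : E3, (∀ q : E3, μ {q} ≠ 0 → q ≠ 0 → y ≠ q) →
      ∑' q : {q : E3 // μ {q} ≠ 0 ∧ q ≠ 0}, lennardJones (dist (0 : E3) (q : E3)) ≤
        ∑' q : {q : E3 // μ {q} ≠ 0 ∧ q ≠ 0}, lennardJones (dist y (q : E3)))
    {y : E3} (hy : μ {y} = 0) :
    2 * rootEnergy lennardJones μ ≤
      (∫⁻ z, ENNReal.ofReal (lennardJones (dist y z)) ∂μ).toReal -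
        (∫⁻ z, ENNReal.ofReal (-lennardJones (dist y z)) ∂μ).toReal + 1 / 12 := by
  classical
  obtain ⟨S, h0, hsep, rfl⟩ := hμ
  have hmem := count_restrict_singleton_ne_zero_iff (E := E3) S
  have hyS : y ∉ S := fun h => (hmem y).2 h hy
  obtain ⟨ρ, hρ, hfar⟩ := exists_pos_forall_le_dist hδ hsep hyS
  have hN := hNash y fun q hq _ h => hyS (h ▸ (hmem q).1 hq)
  have hY : {q : E3 | (Measure.count : Measure E3).restrict S {q} ≠ 0 ∧ q ≠ 0} = S \ {0} := by
    ext q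
    exact ⟨fun h => ⟨(hmem q).1 h.1, fun h0' => h.2 h0'⟩, fun h => ⟨(hmem q).2 h.1, fun h0' => h.2 h0'⟩⟩
  have hL : ∑' q : {q : E3 // (Measure.count : Measure E3).restrict S {q} ≠ 0 ∧ q ≠ 0}, lennardJones (dist (0 : E3) (q : E3)) =
      ∑' q : ↥(S \ {0}), lennardJones (dist (0 : E3) (q : E3)) :=
    tsum_congr_set_coe (fun q : E3 => lennardJones (dist (0 : E3) q)) hY
  have hR : ∑' q : {q : E3 // (Measure.count : Measure E3).restrict S {q} ≠ 0 ∧ q ≠ 0}, lennardJones (dist y (q : E3)) =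
      ∑' q : ↥(S \ {0}), lennardJones (dist y (q : E3)) :=
    tsum_congr_set_coe (fun q : E3 => lennardJones (dist y q)) hY
  rw [hL, hR] at hN
  -- the full series at `y` and its parts
  obtain ⟨-, -, hparts⟩ := tsum_lennardJones_dist_eq_parts hδ hsep hρ hfar
  have hsum := summable_lennardJones_dist hδ hsep hρ hfar
  -- split off the root term
  have hsplit : ∑' q : S, lennardJones (dist y (q : E3)) =
      lennardJones (dist y (0 : E3)) + ∑' q : ↥(S \ {0}), lennardJones (dist y (q : E3)) := by
    rw [hsum.tsum_eq_add_tsum_ite ⟨0, h0⟩]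
    congr 1
    set G : E3 → ℝ := fun x => if x = 0 then 0 else lennardJones (dist y x) with hG
    have h1 : (fun q : S => if q = ⟨0, h0⟩ then (0 : ℝ) else lennardJones (dist y (q : E3))) = fun q : S => G q := by
      funext q
      by_cases hq : (q : E3) = 0
      · have : q = ⟨0, h0⟩ := Subtype.ext hq
        simp [hG, this]
      · have : q ≠ ⟨0, h0⟩ := fun h => hq (by rw [h])
        simp [hG, hq, this]
    have h2 : S.indicator G = (S \ {0}).indicator fun x => lennardJones (dist y x) := by
      funext x
      by_cases hx0 : x = 0
      · subst hx0; simp [hG, indicator]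
      · by_cases hxS : x ∈ S
        · rw [indicator_of_mem hxS, indicator_of_mem (show x ∈ S \ {0} from ⟨hxS, hx0⟩)]; simp [hG, hx0]
        · rw [indicator_of_notMem hxS, indicator_of_notMem (fun h : x ∈ S \ {0} => hxS h.1)]
    rw [h1, tsum_subtype S G, h2, ← tsum_subtype]
  have hV0 : -(1 / 12 : ℝ) ≤ lennardJones (dist y (0 : E3)) := neg_le_lennardJones _
  rw [two_mul_rootEnergy_eq_tsum hδ h0 hsep, ← hparts]
  linarith

end Root

end Summit.AtomisticToContinuum.Crystallization.Theorems.FrustratedLawDichotomyVacancyField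

end
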